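import Summits.ResolutionOfSingularities.ResolutionOfSingularities.Theorems.FrobeniusClosingPatchingRelPerfectDepthMultiHostFormatSnc
import Summits.ResolutionOfSingularities.ResolutionOfSingularities.Theorems.FrobeniusClosingPatchingRelPerfectDepthSNCPointwise
import Summits.ResolutionOfSingularities.ResolutionOfSingularities.Theorems.MarkedTransferCampaignW46ThreefoldsGammaFreeGlobalSNCTransport
import HarnessLib

/-!
# Crux `PatchingRelPerfect` (stmt-ResolutionOfSingularities-16161), chain W5.2 — F7(β) d = 2 (β-AX) A1: FORMAT-SNC END from the
# POINTWISE simple-normal-crossings condition on the open (the U-form wrapper of res-L1-w52-plan-1 RULING G11-17 (2)(i))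

[OURS · L1 W5.2 · F7(β) (β-AX) A1 · res-L1-w52-plan-1 RULING G11-17 (2)(i) «the U-form wrapper», NAMING 16:26:25Z «pv-021: keep … the U-form
wrapper importing pv-046΄s lemma when it lands».]  Replaces the role of NO printed item; NOT a statement of the manuscript under review;
fact-free.  AI-written; AI review is weaker than expert review.  No definitions.

T3/X3 reaches END by proving, at the points of (an open around) the residual cosupport, the POINTWISE condition `DepthSNC.SNCWithAt (𝓒 ++ S.𝓔)
⊤ y` on `X` (res-D-pv-046's openness lemma `DepthSNC.exists_isOpen_forall_sncWithAt'` turns «at every point of Z» into «at every point of an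
open U ⊇ Z»); `MultiHostState.IsFormatSncOn S U 𝓒 𝓗` (p546954) asks instead for `HasSNC` of the family RESTRICTED to the open subscheme `U`.
This file is the bridge:

* `sncAt_iff_sncWithAt_top` — the two pointwise readings in the tree agree: `CampaignW46.SNCAt L y ↔ DepthSNC.SNCWithAt L ⊤ y`.
* `hasSNC_map_comap_ι_of_forall_sncWithAt` — pointwise on `U` ⇒ `HasSNC (L.map (·.comap U.ι))` (res-D-pv-041's B11a
  `CampaignW46.hasSNC_map_comap_ι_of_forall_sncAt`, étale pull-back along `U.ι`).
* **`MultiHostState.isFormatSncOn_of_forall_sncWithAt`** — boundary clause + pointwise snc of `𝓒 ++ S.𝓔` at every point of `U` + the host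
  factorisations on `U` ⇒ `S.IsFormatSncOn U 𝓒 𝓗`.
* **`MultiHostState.isFormatSncOn_of_forall_sncWithAt_of_le`** — the same with the host factorisations given on a LARGER open `U₀ ≥ U`
  (the shape in which the openness lemma is consumed: `U :=` its open `⊇ Z`, intersected with `U₀`).
(The converse «`IsFormatSncOn` ⇒ pointwise on `X`» holds only when distinct members stay distinct on `U` — res-D-pv-041's
`CampaignW46.SNCAt.of_comap_of_isOpenImmersion` with its `InjOn` hypothesis; not restated.)

## References
* E. Bierstone, D. Grigoriev, P. Milman, J. Włodarczyk (2011), Def. 3.1.1, Def. 3.1.5 Remark (1), Thm. 8.0.5. [BierstoneGrigorievMilmanWlodarczyk2011]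
* J. Kollár, *Lectures on Resolution of Singularities* (2007), (3.111) Step 3. [Kollar2007]
-/

-- `Summit.<Summit>.<Sub>.Theorems` with `Sub = Summit` (single-conjunct summit, D-0017)
set_option linter.dupNamespace false

noncomputable section

open CategoryTheory AlgebraicGeometry TopologicalSpace
open Literature.AlgebraicGeometry.Resolution
open Scheme.IdealSheafData

namespace Summit.ResolutionOfSingularities.ResolutionOfSingularities.Theorems.DepthMultiHost

universe u

variable {X : Scheme.{u}}

/-! ## §1 The two pointwise readings agree; pointwise ⇒ restricted -/

/-- **`CampaignW46.SNCAt L y ↔ DepthSNC.SNCWithAt L ⊤ y`** (both are the body of `HasSNC L` at `y`; the centre clause for `⊤` is vacuous).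
[cite: BierstoneGrigorievMilmanWlodarczyk2011, Def. 3.1.1] -/
theorem sncAt_iff_sncWithAt_top (L : List X.IdealSheafData) (y : X) : CampaignW46.SNCAt L y ↔ DepthSNC.SNCWithAt L ⊤ y := by
  refine and_congr Iff.rfl ⟨?_, ?_⟩
  · rintro ⟨u, hu, hι⟩
    refine ⟨_, u, rfl, hu, hι, fun hy => ?_⟩
    rw [Scheme.IdealSheafData.support_top] at hy
    exact absurd (show y ∈ ((⊥ : Closeds X) : Set X) from hy) (by simp [TopologicalSpace.Closeds.coe_bot])
  · rintro ⟨d, v, hd, hv, hι, -⟩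
    subst hd
    exact ⟨v, hv, hι⟩

/-- **Pointwise on `U` ⇒ snc of the restricted family** (B11a `CampaignW46.hasSNC_map_comap_ι_of_forall_sncAt`, read through
`sncAt_iff_sncWithAt_top`). [cite: BierstoneGrigorievMilmanWlodarczyk2011, Def. 3.1.1 with Def. 3.1.5 Remark (1)] -/
theorem hasSNC_map_comap_ι_of_forall_sncWithAt [IsLocallyNoetherian X] (L : List X.IdealSheafData) (U : X.Opens)
    (h : ∀ y ∈ (U : Set X), DepthSNC.SNCWithAt L ⊤ y) : HasSNC (L.map fun D => D.comap U.ι) :=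
  CampaignW46.hasSNC_map_comap_ι_of_forall_sncAt L U fun y hy => (sncAt_iff_sncWithAt_top L y).mpr (h y hy)

/-! ## §2 Format-snc END from pointwise data -/

namespace MultiHostState

variable [IsLocallyNoetherian X] (S : MultiHostState X)

/-- **Format-snc END from POINTWISE snc on `U`**: if every host list lives on `𝓒 ++ S.𝓔`, the family `𝓒 ++ S.𝓔` has simple normal crossings
(pointwise on `X`) at every point of `U`, and every host factors on `U`, then `S.IsFormatSncOn U 𝓒 𝓗`.
[cite: BierstoneGrigorievMilmanWlodarczyk2011, Def. 3.1.1 and Def. 3.1.3] [cite: Kollar2007, (3.111) Step 3] -/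
theorem isFormatSncOn_of_forall_sncWithAt (U : X.Opens) (𝓒 : List X.IdealSheafData) (𝓗 : Fin S.n → List (X.IdealSheafData × ℕ))
    (hb : ∀ i, boundaryOf (𝓗 i) = 𝓒 ++ S.𝓔) (hsnc : ∀ y ∈ (U : Set X), DepthSNC.SNCWithAt (𝓒 ++ S.𝓔) ⊤ y)
    (hhost : ∀ i, (S.host i).comap U.ι = (monomialIdeal (𝓗 i)).comap U.ι) : S.IsFormatSncOn U 𝓒 𝓗 :=
  ⟨hb, hasSNC_map_comap_ι_of_forall_sncWithAt (𝓒 ++ S.𝓔) U hsnc, hhost⟩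

/-- **The same with the host factorisations on a larger open `U₀ ≥ U`** (the consumption shape of res-D-pv-046's openness lemma: `U` = its
open around the residual cosupport, intersected with the open `U₀` carrying the host identities).
[cite: BierstoneGrigorievMilmanWlodarczyk2011, Def. 3.1.3, Thm. 8.0.5] -/
theorem isFormatSncOn_of_forall_sncWithAt_of_le {U U₀ : X.Opens} (hU : U ≤ U₀) (𝓒 : List X.IdealSheafData)
    (𝓗 : Fin S.n → List (X.IdealSheafData × ℕ)) (hb : ∀ i, boundaryOf (𝓗 i) = 𝓒 ++ S.𝓔)
    (hsnc : ∀ y ∈ (U : Set X), DepthSNC.SNCWithAt (𝓒 ++ S.𝓔) ⊤ y)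
    (hhost : ∀ i, (S.host i).comap U₀.ι = (monomialIdeal (𝓗 i)).comap U₀.ι) : S.IsFormatSncOn U 𝓒 𝓗 := by
  refine S.isFormatSncOn_of_forall_sncWithAt U 𝓒 𝓗 hb hsnc fun i => ?_
  rw [← X.homOfLE_ι hU, Scheme.IdealSheafData.comap_comp, Scheme.IdealSheafData.comap_comp, hhost i]

/-- **Pointwise on a set `Z` inside an open carrying the host identities, plus an open `U ⊇ Z` of pointwise snc** (what the openness lemma
`DepthSNC.exists_isOpen_forall_sncWithAt'` returns) **⇒ format-snc END on `U ⊓ U₀ ⊇ Z`.** [cite: BierstoneGrigorievMilmanWlodarczyk2011, Def. 3.1.3] -/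
theorem exists_isFormatSncOn_of_forall_sncWithAt {Z : Set X} {U U₀ : X.Opens} (hZU : Z ⊆ (U : Set X)) (hZU₀ : Z ⊆ (U₀ : Set X))
    (𝓒 : List X.IdealSheafData) (𝓗 : Fin S.n → List (X.IdealSheafData × ℕ)) (hb : ∀ i, boundaryOf (𝓗 i) = 𝓒 ++ S.𝓔)
    (hsnc : ∀ y ∈ (U : Set X), DepthSNC.SNCWithAt (𝓒 ++ S.𝓔) ⊤ y)
    (hhost : ∀ i, (S.host i).comap U₀.ι = (monomialIdeal (𝓗 i)).comap U₀.ι) :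
    ∃ U' : X.Opens, Z ⊆ (U' : Set X) ∧ U' ≤ U₀ ∧ S.IsFormatSncOn U' 𝓒 𝓗 :=
  ⟨U ⊓ U₀, fun _ hx => ⟨hZU hx, hZU₀ hx⟩, inf_le_right,
    S.isFormatSncOn_of_forall_sncWithAt_of_le inf_le_right 𝓒 𝓗 hb (fun y hy => hsnc y hy.1) hhost⟩

end MultiHostState

end Summit.ResolutionOfSingularities.ResolutionOfSingularities.Theorems.DepthMultiHost

end
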